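import Literature.Barriers.MatrixMultiplication.RectangularBarrierCwChain
import HarnessLib

/-!
# The `0.625` barrier on the dual exponent via `CW_q` — `CLLZ2025_alpha_barrier_CW_holds`

Topic `Literature/Barriers/MatrixMultiplication`; DISCHARGE of the named fact `CLLZ2025_alpha_barrier_CW`
of `RectangularBarrier.lean` (Christandl–Le Gall–Lysikov–Zuiddam, *Barriers for rectangular matrix
multiplication*, comput. complexity 34 (2025) = arXiv:2003.03019; v1 abstract and §1.3.1: "any lower
bound on the dual exponent of matrix multiplication `α` via the big Coppersmith–Winograd tensors cannot
exceed `0.625`"): for every field `K`, every `q ≥ 2` and every `CW_q`-method lower bound `p` on `α`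
(`IsTMethodAlphaBound K CW_q p`: reductions `CW_q^{⊗k} ≥ ⟨s⟩ ⊗ ⟨n,n,m⟩`, `m ≥ n^{p−o(1)}`, certifying
`ω(p) ≤ 2`), `p ≤ 0.625`.

## Proof

The printed route (Thm. 3.22 with Lemma 4.1/4.2 and the program (9)–(11) of §4.4, evaluated by a
solver at `θ₁ = 0.999999`, Table 3) is made exact. By `alpha_bigCw_le_of_costs`
(`RectangularBarrierCwChain.lean`) a dual certificate — three positive three-level vectors
`Qᵢ = (αᵢ, βᵢ ×q, γᵢ)` of mass `≤ 1` whose six costs on `supp CW_q` are `≤ h ≤ log₂(q+2)` — gives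
`p ≤ (2h/log₂(q+2) − (1+θ 1))/(1 − θ 1)`. Take `θ = (τ, 1 − 2τ, τ)` and `h = (1 − 3τ/8) log₂(q+2)`; then
the bound is EXACTLY `5/8` for every `τ ∈ (0, ½)` (`alpha_bigCw_le_of_triple`). With `Q₁ = Q₃ = (α, β, γ)`
and the exponentially tilted `Q₂ = (e^{−σu₀}, e^{−σδ} ×q, e^{−σu_e})/(q+2)`, `σ = τ/(1−2τ)`,
`δ = (13/8) ln(q+2) + ln α + ln β`, `u₀ = (13/8) ln(q+2) + 2 ln β`, `u_e = (13/8) ln(q+2) + 2 ln α`, five of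
the six costs EQUAL `h` identically and the sixth is `≤ h` iff `β² ≤ αγ`; the mass of `Q₂` is `≤ 1` for all
small `σ > 0` as soon as `δ > 0` (`exists_exp_tilt_mass_le`, via `e^{−y} ≤ 1 − y + y²`), i.e. as soon as
`(q+2)^{13} (αβ)^8 > 1`. So it suffices to exhibit, for each `q ≥ 2`, rationals `α, β, γ > 0` with
`α + qβ + γ ≤ 1`, `β² ≤ αγ`, `(q+2)^{13}(αβ)^8 > 1` — pure arithmetic (`norm_num`):
`q = 2`: `(9/16, 3/16, 1/16)` (the exact optimum, `3^{24} > 2^{38}`; value `3 − (3/2)log₂ 3 = 0.62256`);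
`q = 3`: `(43/80, 17/120, 3/80)`; `q = 4`: `(21/40, 9/80, 1/40)`; `q = 5`: `(13/25, 37/400, 7/400)`;
`q ≥ 6`: `(1/2, 1/(2(q+1)), 1/(2(q+1)²))` with `(q+2)^{13} > 2^{16}(q+1)^8` (`q = 6, 7` numerically,
`q ≥ 8` since `(q+2)^5 ≥ 10^5 > 2^{16}`). In the limit `τ → 0` the certificate value is
`log₂(1/(αβ))/log₂(q+2) − 1`, the `θ₁ → 1` limit `g*(q)` of the printed §4.3 expression (the entry's
"Numerics" note in `RectangularBarrier.lean`); `0.625 ≥ g*(q)` for all `q ≥ 2` with equality nowhere.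

References: CLLZ 2025, Thm. 3.22, §4.3–4.4, Table 3, App. A; v1 (2020) abstract, §1.3.1, Fig. 2.
-/

noncomputable section

open scoped BigOperators

namespace Literature.Barriers.MatrixMultiplication

open Literature.Computability.AlgebraicComplexity

/-! ## The exponential tilt -/

/-- **Mass of the tilted vector.** For `q ≥ 0`, `δ > 0` and `u₀ + u_e = 2δ` there is `σ > 0` with
`e^{−σu₀} + q e^{−σδ} + e^{−σu_e} ≤ q + 2` (the derivative at `σ = 0` is `−(q+2)δ < 0`; quantitatively
`e^{−y} ≤ 1 − y + y²` for `|y| ≤ 1`). [folklore] -/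
theorem exists_exp_tilt_mass_le {q : ℝ} (hq : 0 ≤ q) {u₀ uₑ δ : ℝ} (hδ : 0 < δ)
    (hsum : u₀ + uₑ = 2 * δ) :
    ∃ σ : ℝ, 0 < σ ∧
      Real.exp (-(σ * u₀)) + q * Real.exp (-(σ * δ)) + Real.exp (-(σ * uₑ)) ≤ q + 2 := by
  -- `M` bounds `|u₀|, |u_e|, δ`; `S = u₀² + q δ² + u_e²`
  set M := max (|u₀|) (max (|uₑ|) δ) with hM
  have hMδ : δ ≤ M := le_trans (le_max_right _ _) (le_max_right _ _)
  have hM0 : 0 < M := hδ.trans_le hMδ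
  have hu₀M : |u₀| ≤ M := le_max_left _ _
  have huₑM : |uₑ| ≤ M := le_trans (le_max_left _ _) (le_max_right _ _)
  set S := u₀ ^ 2 + q * δ ^ 2 + uₑ ^ 2 with hS
  have hS0 : 0 < S := by
    have : 0 < δ ^ 2 := by positivity
    have h1 : 0 ≤ u₀ ^ 2 := sq_nonneg _
    have h2 : 0 ≤ uₑ ^ 2 := sq_nonneg _
    have h3 : 0 ≤ q * δ ^ 2 := by positivity
    -- `u₀ + u_e = 2δ > 0` forces `u₀ ≠ 0 ∨ u_e ≠ 0`
    rcases eq_or_ne u₀ 0 with h0 | h0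
    · have : uₑ = 2 * δ := by linarith
      rw [hS, h0, this]; positivity
    · have : 0 < u₀ ^ 2 := by positivity
      linarith
  set σ := min (1 / M) ((q + 2) * δ / S) with hσ
  have hσ0 : 0 < σ := lt_min (by positivity) (by positivity)
  have hσM : σ * M ≤ 1 := by
    have : σ ≤ 1 / M := min_le_left _ _
    rwa [le_div_iff₀ hM0] at this
  have hσS : σ * S ≤ (q + 2) * δ := by
    have : σ ≤ (q + 2) * δ / S := min_le_right _ _
    rwa [le_div_iff₀ hS0] at this
  refine ⟨σ, hσ0, ?_⟩
  -- `e^{-y} ≤ 1 - y + y²` for `|y| ≤ 1` (cf. `exp_neg_le_one_sub_add_sq` in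
  -- `Probability/RandomMatrixProducts/AndersonModel1DEstimates.lean`)
  have exp_neg_le_one_sub_add_sq : ∀ {y : ℝ}, |y| ≤ 1 → Real.exp (-y) ≤ 1 - y + y ^ 2 := by
    intro y hy
    have h := Real.abs_exp_sub_one_sub_id_le (x := -y) (by rwa [abs_neg])
    have h' := (abs_le.1 h).2
    nlinarith [h']
  -- each exponent has absolute value `≤ 1`
  have hb : ∀ u : ℝ, |u| ≤ M → |σ * u| ≤ 1 := fun u hu => by
    rw [abs_mul, abs_of_pos hσ0]
    calc σ * |u| ≤ σ * M := mul_le_mul_of_nonneg_left hu hσ0.le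
      _ ≤ 1 := hσM
  have e₀ := exp_neg_le_one_sub_add_sq (hb u₀ hu₀M)
  have eₑ := exp_neg_le_one_sub_add_sq (hb uₑ huₑM)
  have eδ := exp_neg_le_one_sub_add_sq (hb δ (by rwa [abs_of_pos hδ]))
  have eδ' : q * Real.exp (-(σ * δ)) ≤ q * (1 - σ * δ + (σ * δ) ^ 2) := mul_le_mul_of_nonneg_left eδ hq
  -- sum: `≤ (q+2) − σ (q+2) δ + σ² S ≤ q + 2`
  have key : (1 - σ * u₀ + (σ * u₀) ^ 2) + q * (1 - σ * δ + (σ * δ) ^ 2) + (1 - σ * uₑ + (σ * uₑ) ^ 2) =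
      (q + 2) - σ * ((q + 2) * δ) + σ * (σ * S) := by
    rw [hS]
    linear_combination (-σ) * hsum
  have hfin : (q + 2) - σ * ((q + 2) * δ) + σ * (σ * S) ≤ q + 2 := by
    have := mul_le_mul_of_nonneg_left hσS hσ0.le
    linarith
  linarith [e₀, eₑ, eδ', key, hfin]

/-! ## The certificate from a triple `(α, β, γ)` -/

/-- **The `CW_q` barrier on `α` from a rational triple.** If `α, β, γ > 0`, `α + qβ + γ ≤ 1`, `β² ≤ αγ`
and `(q+2)^{13} (αβ)^8 > 1`, then every `CW_q`-method lower bound `p` on `α` satisfies `p ≤ 5/8`: take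
`θ = (τ, 1−2τ, τ)`, `Q₁ = Q₃ = (α, β ×q, γ)`, `Q₂` the exponential tilt of the uniform vector with
`σ = τ/(1−2τ)` small, and `h = (1 − 3τ/8) log₂(q+2)` in `alpha_bigCw_le_of_costs`; the resulting bound
`(2h/log₂(q+2) − (2−2τ))/(2τ)` equals `5/8`. (CLLZ Thm. 3.22 with §4.3 for `CW_q`, the program of §4.4
bounded by an explicit dual point near the `θ₁ → 1` vertex.) [cite: ChristandlLeGallLysikovZuiddam2025, §4.3] -/
theorem alpha_bigCw_le_of_triple (q : ℕ) {α β γ : ℝ} (hα : 0 < α) (hβ : 0 < β) (hγ : 0 < γ)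
    (hk : α + q * β + γ ≤ 1) (hβ2 : β ^ 2 ≤ α * γ) (hd : 1 < ((q : ℝ) + 2) ^ 13 * (α * β) ^ 8)
    {K : Type} [Field K] {p : ℝ} (hp : IsTMethodAlphaBound K (bigCwTensor K q) p) : p ≤ 5 / 8 := by
  have hq0 : (0 : ℝ) ≤ q := Nat.cast_nonneg q
  have hq2 : (0 : ℝ) < q + 2 := by positivity
  set Lq := Real.log ((q : ℝ) + 2) with hLq
  have hLq0 : 0 < Lq := Real.log_pos (by linarith)
  set L2 := Real.log 2 with hL2
  have hL20 : 0 < L2 := Real.log_pos one_lt_two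
  -- `δ > 0` from `(q+2)^13 (αβ)^8 > 1`
  set δ := (13 / 8) * Lq + Real.log α + Real.log β with hδ
  have hδ0 : 0 < δ := by
    have h := Real.log_pos hd
    rw [Real.log_mul (by positivity) (by positivity), Real.log_pow, Real.log_pow,
      Real.log_mul hα.ne' hβ.ne'] at h
    rw [hδ]
    push_cast at h
    nlinarith [h]
  set u₀ := (13 / 8) * Lq + 2 * Real.log β with hu₀
  set uₑ := (13 / 8) * Lq + 2 * Real.log α with huₑ
  obtain ⟨σ, hσ0, hmass⟩ := exists_exp_tilt_mass_le hq0 hδ0 (u₀ := u₀) (uₑ := uₑ)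
    (by rw [hu₀, huₑ, hδ]; ring)
  -- `τ = σ/(1+2σ)` and `θ = (τ, 1−2τ, τ)`
  set τ := σ / (1 + 2 * σ) with hτ
  have h12σ : 0 < 1 + 2 * σ := by linarith
  have hτ0 : 0 < τ := div_pos hσ0 h12σ
  have hτhalf : 2 * τ < 1 := by
    rw [hτ, mul_div_assoc', div_lt_one h12σ]; linarith
  have hτσ : (1 - 2 * τ) * σ = τ := by
    rw [hτ]; field_simp; ring
  set θ : Fin 3 → ℝ := fun i => if i = 1 then 1 - 2 * τ else τ with hθ
  have hθ0 : θ 0 = τ := if_neg (by decide)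
  have hθ1 : θ 1 = 1 - 2 * τ := if_pos rfl
  have hθ2 : θ 2 = τ := if_neg (by decide)
  have hθs : θ ∈ stdSimplex ℝ (Fin 3) := by
    refine ⟨fun i => ?_, ?_⟩
    · show 0 ≤ (if i = 1 then 1 - 2 * τ else τ)
      split_ifs <;> linarith
    · rw [Fin.sum_univ_three, hθ0, hθ1, hθ2]; ring
  have hθ1lt : θ 1 < 1 := by rw [hθ1]; linarith
  -- the tilted `Q₂`
  set a₂ := Real.exp (-(σ * u₀)) / (q + 2) with ha₂
  set b₂ := Real.exp (-(σ * δ)) / (q + 2) with hb₂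
  set g₂ := Real.exp (-(σ * uₑ)) / (q + 2) with hg₂
  have ha₂0 : 0 < a₂ := div_pos (Real.exp_pos _) hq2
  have hb₂0 : 0 < b₂ := div_pos (Real.exp_pos _) hq2
  have hg₂0 : 0 < g₂ := div_pos (Real.exp_pos _) hq2
  have hmass' : a₂ + q * b₂ + g₂ ≤ 1 := by
    rw [ha₂, hb₂, hg₂, mul_div_assoc', ← add_div, ← add_div, div_le_one hq2]
    exact hmass
  have hla₂ : -Real.log a₂ = σ * u₀ + Lq := by
    rw [ha₂, Real.log_div (Real.exp_pos _).ne' hq2.ne', Real.log_exp]; ring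
  have hlb₂ : -Real.log b₂ = σ * δ + Lq := by
    rw [hb₂, Real.log_div (Real.exp_pos _).ne' hq2.ne', Real.log_exp]; ring
  have hlg₂ : -Real.log g₂ = σ * uₑ + Lq := by
    rw [hg₂, Real.log_div (Real.exp_pos _).ne' hq2.ne', Real.log_exp]; ring
  -- `h = (1 − 3τ/8) log₂(q+2)`
  have hlogb : Real.logb 2 ((q : ℝ) + 2) = Lq / L2 := rfl
  set h := (1 - 3 / 8 * τ) * (Lq / L2) with hh
  have h38 : 0 < 1 - 3 / 8 * τ := by linarith
  have hh0 : 0 < h := mul_pos h38 (div_pos hLq0 hL20)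
  have hhL : h ≤ Real.logb 2 ((q : ℝ) + 2) := by
    rw [hlogb, hh]
    have : (1 - 3 / 8 * τ) * (Lq / L2) ≤ 1 * (Lq / L2) :=
      mul_le_mul_of_nonneg_right (by linarith) (div_pos hLq0 hL20).le
    linarith
  -- `2 log β ≤ log α + log γ`
  have hβ2' : 2 * Real.log β ≤ Real.log α + Real.log γ := by
    have := Real.log_le_log (by positivity) hβ2
    rw [Real.log_pow, Real.log_mul hα.ne' hγ.ne'] at this
    push_cast at this
    exact this
  have hL2ne : L2 ≠ 0 := hL20.ne'
  -- the five identities and one inequality, all in the form `cost = (expression)/L2`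
  have cost_eq : ∀ x y z : ℝ, τ * (x / L2) + (1 - 2 * τ) * (y / L2) + τ * (z / L2) =
      (τ * x + (1 - 2 * τ) * y + τ * z) / L2 := fun x y z => by
    field_simp
  have hval : h = ((1 - 2 * τ) * Lq + (13 / 8) * τ * Lq) / L2 := by
    rw [hh]; field_simp; ring
  -- (0,i,i): τ(-log α) + (1-2τ)(-log b₂) + τ(-log β) = h
  have cA : θ 0 * (-Real.log α / L2) + θ 1 * (-Real.log b₂ / L2) + θ 2 * (-Real.log β / L2) ≤ h := by
    rw [hθ0, hθ1, hθ2, cost_eq, hlb₂, hval]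
    refine le_of_eq ?_
    congr 1
    have : (1 - 2 * τ) * (σ * δ) = τ * δ := by linear_combination δ * hτσ
    rw [mul_add, this, hδ]; ring
  -- (i,0,i): τ(-log β) + (1-2τ)(-log a₂) + τ(-log β) = h
  have cB : θ 0 * (-Real.log β / L2) + θ 1 * (-Real.log a₂ / L2) + θ 2 * (-Real.log β / L2) ≤ h := by
    rw [hθ0, hθ1, hθ2, cost_eq, hla₂, hval]
    refine le_of_eq ?_
    congr 1
    have : (1 - 2 * τ) * (σ * u₀) = τ * u₀ := by linear_combination u₀ * hτσ
    rw [mul_add, this, hu₀]; ring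
  -- (i,i,0): τ(-log β) + (1-2τ)(-log b₂) + τ(-log α) = h
  have cC : θ 0 * (-Real.log β / L2) + θ 1 * (-Real.log b₂ / L2) + θ 2 * (-Real.log α / L2) ≤ h := by
    rw [hθ0, hθ1, hθ2, cost_eq, hlb₂, hval]
    refine le_of_eq ?_
    congr 1
    have : (1 - 2 * τ) * (σ * δ) = τ * δ := by linear_combination δ * hτσ
    rw [mul_add, this, hδ]; ring
  -- (0,0,q+1): τ(-log α) + (1-2τ)(-log a₂) + τ(-log γ) ≤ h  (uses β² ≤ αγ)
  have cD : θ 0 * (-Real.log α / L2) + θ 1 * (-Real.log a₂ / L2) + θ 2 * (-Real.log γ / L2) ≤ h := by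
    rw [hθ0, hθ1, hθ2, cost_eq, hla₂, hval]
    refine div_le_div_of_nonneg_right ?_ hL20.le
    have : (1 - 2 * τ) * (σ * u₀) = τ * u₀ := by linear_combination u₀ * hτσ
    rw [mul_add, this, hu₀]
    have hm := mul_le_mul_of_nonneg_left hβ2' hτ0.le
    linarith [hm]
  -- (0,q+1,0): τ(-log α) + (1-2τ)(-log g₂) + τ(-log α) = h
  have cE : θ 0 * (-Real.log α / L2) + θ 1 * (-Real.log g₂ / L2) + θ 2 * (-Real.log α / L2) ≤ h := by
    rw [hθ0, hθ1, hθ2, cost_eq, hlg₂, hval]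
    refine le_of_eq ?_
    congr 1
    have : (1 - 2 * τ) * (σ * uₑ) = τ * uₑ := by linear_combination uₑ * hτσ
    rw [mul_add, this, huₑ]; ring
  -- (q+1,0,0): τ(-log γ) + (1-2τ)(-log a₂) + τ(-log α) ≤ h
  have cF : θ 0 * (-Real.log γ / L2) + θ 1 * (-Real.log a₂ / L2) + θ 2 * (-Real.log α / L2) ≤ h := by
    rw [hθ0, hθ1, hθ2, cost_eq, hla₂, hval]
    refine div_le_div_of_nonneg_right ?_ hL20.le
    have : (1 - 2 * τ) * (σ * u₀) = τ * u₀ := by linear_combination u₀ * hτσ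
    rw [mul_add, this, hu₀]
    have hm := mul_le_mul_of_nonneg_left hβ2' hτ0.le
    linarith [hm]
  have hbound := alpha_bigCw_le_of_costs q hθs hθ1lt hα hβ hγ ha₂0 hb₂0 hg₂0 hα hβ hγ hk hmass' hk hh0
    hhL cA cB cC cD cE cF hp
  -- the bound is exactly `5/8`
  have hfinal : (2 * h / Real.logb 2 ((q : ℝ) + 2) - (1 + θ 1)) / (1 - θ 1) = 5 / 8 := by
    rw [hlogb, hθ1, hh]
    have hLq' : Lq / L2 ≠ 0 := (div_pos hLq0 hL20).ne'
    field_simp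
    ring
  rw [hfinal] at hbound
  exact hbound

/-! ## The triples -/

/-- `q = 2`: the triple `(9/16, 3/16, 1/16)` (the exact optimum: value `3 − (3/2) log₂ 3 = 0.62256`,
certified through `3^{24} > 2^{38}`). [cite: ChristandlLeGallLysikovZuiddam2025, §4.4 (Table 3)] -/
theorem alpha_bigCw_two_le {K : Type} [Field K] {p : ℝ} (hp : IsTMethodAlphaBound K (bigCwTensor K 2) p) :
    p ≤ 5 / 8 :=
  alpha_bigCw_le_of_triple 2 (α := 9 / 16) (β := 3 / 16) (γ := 1 / 16) (by norm_num) (by norm_num)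
    (by norm_num) (by norm_num) (by norm_num) (by norm_num) hp

/-- `q = 3`: the triple `(43/80, 17/120, 3/80)`. [cite: ChristandlLeGallLysikovZuiddam2025, §4.4 (Table 3)] -/
theorem alpha_bigCw_three_le {K : Type} [Field K] {p : ℝ}
    (hp : IsTMethodAlphaBound K (bigCwTensor K 3) p) : p ≤ 5 / 8 :=
  alpha_bigCw_le_of_triple 3 (α := 43 / 80) (β := 17 / 120) (γ := 3 / 80) (by norm_num) (by norm_num)
    (by norm_num) (by norm_num) (by norm_num) (by norm_num) hp

/-- `q = 4`: the triple `(21/40, 9/80, 1/40)`. [cite: ChristandlLeGallLysikovZuiddam2025, §4.4 (Table 3)] -/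
theorem alpha_bigCw_four_le {K : Type} [Field K] {p : ℝ}
    (hp : IsTMethodAlphaBound K (bigCwTensor K 4) p) : p ≤ 5 / 8 :=
  alpha_bigCw_le_of_triple 4 (α := 21 / 40) (β := 9 / 80) (γ := 1 / 40) (by norm_num) (by norm_num)
    (by norm_num) (by norm_num) (by norm_num) (by norm_num) hp

/-- `q = 5`: the triple `(13/25, 37/400, 7/400)`. [cite: ChristandlLeGallLysikovZuiddam2025, §4.4 (Table 3)] -/
theorem alpha_bigCw_five_le {K : Type} [Field K] {p : ℝ}
    (hp : IsTMethodAlphaBound K (bigCwTensor K 5) p) : p ≤ 5 / 8 :=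
  alpha_bigCw_le_of_triple 5 (α := 13 / 25) (β := 37 / 400) (γ := 7 / 400) (by norm_num) (by norm_num)
    (by norm_num) (by norm_num) (by norm_num) (by norm_num) hp

/-- The arithmetic behind the uniform triple for `q ≥ 6`: `2^{16} (q+1)^8 < (q+2)^{13}`. [folklore] -/
theorem pow_ineq_of_six_le {q : ℕ} (hq : 6 ≤ q) : 2 ^ 16 * (q + 1) ^ 8 < (q + 2) ^ 13 := by
  by_cases h8 : 8 ≤ q
  · have h1 : (q + 1) ^ 8 ≤ (q + 2) ^ 8 := Nat.pow_le_pow_left (by omega) 8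
    have h2 : 10 ^ 5 ≤ (q + 2) ^ 5 := Nat.pow_le_pow_left (by omega) 5
    have h3 : 0 < (q + 1) ^ 8 := by positivity
    calc 2 ^ 16 * (q + 1) ^ 8 < 10 ^ 5 * (q + 1) ^ 8 := by
          apply Nat.mul_lt_mul_of_lt_of_le (by norm_num) le_rfl h3
      _ ≤ (q + 2) ^ 5 * (q + 2) ^ 8 := Nat.mul_le_mul h2 h1
      _ = (q + 2) ^ 13 := by rw [← pow_add]
  · interval_cases q <;> norm_num

/-- `q ≥ 6`: the triple `(1/2, 1/(2(q+1)), 1/(2(q+1)²))`. [cite: ChristandlLeGallLysikovZuiddam2025, §4.4 (Table 3)] -/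
theorem alpha_bigCw_le_of_six_le {q : ℕ} (hq : 6 ≤ q) {K : Type} [Field K] {p : ℝ}
    (hp : IsTMethodAlphaBound K (bigCwTensor K q) p) : p ≤ 5 / 8 := by
  have hq0 : (0 : ℝ) ≤ q := Nat.cast_nonneg q
  have hq1 : (0 : ℝ) < q + 1 := by positivity
  refine alpha_bigCw_le_of_triple q (α := 1 / 2) (β := 1 / (2 * (q + 1))) (γ := 1 / (2 * (q + 1) ^ 2))
    (by norm_num) (by positivity) (by positivity) ?_ ?_ ?_ hp
  · have e : (1 : ℝ) / 2 + q * (1 / (2 * (q + 1))) + 1 / (2 * (q + 1) ^ 2) =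
        1 - q / (2 * (q + 1) ^ 2) := by
      field_simp
      ring
    rw [e]
    have : 0 ≤ (q : ℝ) / (2 * (q + 1) ^ 2) := by positivity
    linarith
  · refine le_of_eq ?_
    field_simp
  · have e : ((q : ℝ) + 2) ^ 13 * (1 / 2 * (1 / (2 * (q + 1)))) ^ 8 =
        ((q : ℝ) + 2) ^ 13 / (2 ^ 16 * (q + 1) ^ 8) := by
      field_simp
    rw [e, one_lt_div (by positivity)]
    exact_mod_cast pow_ineq_of_six_le hq

/-- **For every `q ≥ 2`**: every `CW_q`-method lower bound on `α` is `≤ 5/8`.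
[cite: ChristandlLeGallLysikovZuiddam2020, §1.3.1] -/
theorem alpha_bigCw_le {q : ℕ} (hq : 2 ≤ q) {K : Type} [Field K] {p : ℝ}
    (hp : IsTMethodAlphaBound K (bigCwTensor K q) p) : p ≤ 5 / 8 := by
  by_cases h6 : 6 ≤ q
  · exact alpha_bigCw_le_of_six_le h6 hp
  · interval_cases q
    · exact alpha_bigCw_two_le hp
    · exact alpha_bigCw_three_le hp
    · exact alpha_bigCw_four_le hp
    · exact alpha_bigCw_five_le hp

/-! ## The discharge -/

/-- **CLLZ, the `0.625` barrier on `α` via the big Coppersmith–Winograd tensors, PROVED**: the named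
fact `CLLZ2025_alpha_barrier_CW` of `RectangularBarrier.lean` holds — for every field `K`, every `q ≥ 2`
and every `CW_q`-method lower bound `p` on the dual exponent (`IsTMethodAlphaBound`), `p ≤ 0.625`.
[cite: ChristandlLeGallLysikovZuiddam2020, abstract and §1.3.1 (Fig. 2)] -/
theorem CLLZ2025_alpha_barrier_CW_holds : CLLZ2025_alpha_barrier_CW := by
  intro K _ q hq p hp
  change IsTMethodAlphaBound K (bigCwTensor K q) p at hp
  have h := alpha_bigCw_le hq hp
  norm_num
  exact h

/-- With the headline numerics discharged: a `CW_q`-method (`q ≥ 2`) can certify `p ≤ α` only for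
`p ≤ 0.625 < 1`, unconditionally (`CLLZ2025_alpha_barrier_CW.lt_one`).
[cite: ChristandlLeGallLysikovZuiddam2020, §1.3.1] -/
theorem alpha_bigCw_lt_one (K : Type) [Field K] {q : ℕ} (hq : 2 ≤ q) {p : ℝ}
    (hp : IsTMethodAlphaBound K (bigCwTensor K q) p) : p < 1 :=
  (alpha_bigCw_le hq hp).trans_lt (by norm_num)

end Literature.Barriers.MatrixMultiplication

end
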